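import Mathlib
import Summits.QuantumFields.QCD.Theorems.QuarksAsStableActionUnquenchedChessboardBoundLinkGramIdentity
import Summits.QuantumFields.QCD.Theorems.QuarksAsStableActionUnquenchedChessboardBoundLinkGramFormAux
import Summits.QuantumFields.QCD.Theorems.QuarksAsStableActionUnquenchedChessboardBoundGramCS
import HarnessLib

/-!
# Link Gram identity, part 9b: the link Gram inequality `stub_linkGram`
(crux stmt-QuantumFields-9735, line `Sketch`, lead's stub)

The fermionic features `linkFeat κ U = ∏_f ρ(Q_F[W U, m_f])_{κ_f}` (products over flavours of
row-replacement determinants of the upper block in the twisted lifted temporal-gauge field) are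
admissible (continuous ⇒ measurable and bounded; they depend on positive-time links only), and the
three gauge-fixed integrals are values of the reflection-positive form `B = linkForm β`:
`Zc(full slab) = K₀ Σ_κ W_κ B(Φ_κ, Φ_κ)`, `Zc(upper half) = K₀ C B(1, Φ_{κ₀})`,
`Zc(∅) = K₀ C² B(1, 1)` (`K₀ > 0`, `W_κ ∈ {0,1}`, `C = ∏_f (m_f+4)^n`). The Cauchy–Schwarz
inequality for Gram sums of `B` (`norm_sum_form_sq_le`) is then `stub_linkGram`.
All statements are proved.
-/

noncomputable section

open MeasureTheory Matrix Complex Finset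
open Literature.MathematicalPhysics.QuantumFieldTheory Literature.MathematicalPhysics.QuantumLattice
open Literature.Probability.LatticeModels (TorusSite)
open Summit.QuantumFields.QCD.Theorems.QuarksAsStableAction
open scoped ComplexConjugate BigOperators ComplexOrder

namespace Summit.QuantumFields.QCD.Theorems.UnquenchedChessboardBoundLine

variable {L N : ℕ} [NeZero L] [Fact (1 < L)]

/-! ## The upper block as a function of the field: congruence and continuity -/

omit [Fact (1 < L)] in
/-- The upper block only evaluates the field on bonds between upper sites. -/
theorem linkQ_congr_field {G : Type*} [Group G] (ρ : G →* Matrix (Fin N) (Fin N) ℂ) (p : ℕ)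
    (F : Finset (Edge 4 L)) {W₁ W₂ : GaugeConfig 4 L G}
    (h : ∀ e : Edge 4 L, e.1 ∈ linkUpSites p → e.1.shift e.2 ∈ linkUpSites p → W₁ e = W₂ e) (m : ℝ) :
    linkQ ρ p F W₁ m = linkQ ρ p F W₂ m := by
  ext i j
  simp only [linkQ, Matrix.of_apply, bondWilsonDiracG_apply]
  set u := (linkUpEnum L N p i).1
  set v := (linkUpEnum L N p j).1
  have hxu : u.1 ∈ linkUpSites p := (linkUpEnum L N p i).2
  have hxv : v.1 ∈ linkUpSites p := (linkUpEnum L N p j).2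
  congr 1
  congr 1
  refine Finset.sum_congr rfl fun μ _ => ?_
  congr 1
  · split_ifs with hc
    · rw [h (u.1, μ) hxu (hc.1 ▸ hxv)]
    · rfl
  · split_ifs with hc
    · rw [h (v.1, μ) hxv (hc.1 ▸ hxu)]
    · rfl

omit [Fact (1 < L)] in
/-- Row-replacement determinants depend continuously on the matrix. -/
theorem continuous_rho_comp' {X : Type*} [TopologicalSpace X] {n : ℕ} {A : X → Matrix (Fin n) (Fin n) ℂ}
    (hA : Continuous A) (S T : Finset (Fin n)) : Continuous fun x => rho (A x) S T := by
  unfold rho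
  split_ifs with h
  · refine Continuous.matrix_det ?_
    refine continuous_pi fun r => continuous_pi fun c => ?_
    simp only [rowRep, Matrix.of_apply]
    split_ifs
    · exact continuous_const
    · exact hA.matrix_elem r c
  · exact continuous_const

omit [Fact (1 < L)] in
/-- The matrix of a link of the twisted lifted field depends continuously on the configuration. -/
theorem continuous_linkField_coe (e : Edge 4 L) :
    Continuous fun U : GaugeConfig 4 L (Matrix.specialUnitaryGroup (Fin N) ℂ) =>
      ((linkField U e : Matrix.unitaryGroup (Fin N) ℂ) : Matrix (Fin N) (Fin N) ℂ) := by
  simp only [linkField_apply]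
  split_ifs with hs hcross hcross'
  · exact continuous_const
  · show Continuous fun U : GaugeConfig 4 L (Matrix.specialUnitaryGroup (Fin N) ℂ) =>
      -(((U e : Matrix.specialUnitaryGroup (Fin N) ℂ) : Matrix (Fin N) (Fin N) ℂ))
    exact (continuous_subtype_val.comp (continuous_apply e)).neg
  · exact continuous_const
  · show Continuous fun U : GaugeConfig 4 L (Matrix.specialUnitaryGroup (Fin N) ℂ) =>
      ((U e : Matrix.specialUnitaryGroup (Fin N) ℂ) : Matrix (Fin N) (Fin N) ℂ)
    exact continuous_subtype_val.comp (continuous_apply e)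

omit [Fact (1 < L)] in
/-- The upper block depends continuously on the configuration. -/
theorem continuous_linkQ_linkField (p : ℕ) (F : Finset (Edge 4 L)) (m : ℝ) :
    Continuous fun U : GaugeConfig 4 L (Matrix.specialUnitaryGroup (Fin N) ℂ) =>
      linkQ (unitaryFundamentalRep (Fin N) ℂ) p F (linkField U) m := by
  refine continuous_pi fun i => continuous_pi fun j => ?_
  simp only [linkQ, Matrix.of_apply, bondWilsonDiracG_apply, unitaryFundamentalRep_apply]
  refine continuous_const.sub (continuous_const.mul (continuous_finsetSum _ fun μ _ => ?_))
  refine Continuous.add ?_ ?_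
  · split_ifs
    · exact continuous_const.mul ((continuous_linkField_coe _).matrix_elem _ _)
    · exact continuous_const
  · split_ifs
    · refine continuous_const.mul ?_
      have : (fun U : GaugeConfig 4 L (Matrix.specialUnitaryGroup (Fin N) ℂ) =>
          (((linkField U ((linkUpEnum L N p j).1.1, μ))⁻¹ : Matrix.unitaryGroup (Fin N) ℂ) :
            Matrix (Fin N) (Fin N) ℂ) ((linkUpEnum L N p i).1).2.1 ((linkUpEnum L N p j).1).2.1) =
          fun U => star (((linkField U ((linkUpEnum L N p j).1.1, μ)) : Matrix.unitaryGroup (Fin N) ℂ) :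
            Matrix (Fin N) (Fin N) ℂ) ((linkUpEnum L N p i).1).2.1 ((linkUpEnum L N p j).1).2.1 := by
        funext U; rfl
      rw [this]
      exact (continuous_star.comp (continuous_linkField_coe _)).matrix_elem _ _
    · exact continuous_const

/-! ## The fermionic features -/

/-- **The fermionic features** `Φ_κ(U) = ∏_f ρ(Q_F[W U, m_f])_{S_f, T_f}`. -/
def linkFeat {Nf : ℕ} (p : ℕ) (F : Finset (Edge 4 L)) (m : Fin Nf → ℝ)
    (κ : Fin Nf → Finset (Fin (linkUpCard L N p)) × Finset (Fin (linkUpCard L N p)))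
    (U : GaugeConfig 4 L (Matrix.specialUnitaryGroup (Fin N) ℂ)) : ℂ :=
  ∏ f, rho (linkQ (unitaryFundamentalRep (Fin N) ℂ) p F (linkField U) (m f)) (κ f).1 (κ f).2

/-- The product weights `W_κ = ∏_f w(κ_f) ∈ {0, 1}`. -/
def linkWt {Nf : ℕ} (L N p : ℕ) [NeZero L]
    (κ : Fin Nf → Finset (Fin (linkUpCard L N p)) × Finset (Fin (linkUpCard L N p))) : ℂ :=
  ∏ f, linkWeight L N p (κ f).1 (κ f).2

omit [Fact (1 < L)] in
/-- The product weights are `0` or `1`. -/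
theorem linkWt_eq_zero_or_one {Nf : ℕ} (p : ℕ)
    (κ : Fin Nf → Finset (Fin (linkUpCard L N p)) × Finset (Fin (linkUpCard L N p))) :
    linkWt L N p κ = 0 ∨ linkWt L N p κ = 1 := by
  unfold linkWt
  by_cases h : ∃ f, linkWeight L N p (κ f).1 (κ f).2 = 0
  · obtain ⟨f, hf⟩ := h
    exact Or.inl (Finset.prod_eq_zero (Finset.mem_univ f) hf)
  · push Not at h
    refine Or.inr (Finset.prod_eq_one fun f _ => ?_)
    rcases linkWeight_eq_zero_or_one p (κ f).1 (κ f).2 with h0 | h1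
    · exact absurd h0 (h f)
    · exact h1

omit [Fact (1 < L)] in
/-- The features are continuous. -/
theorem continuous_linkFeat {Nf : ℕ} (p : ℕ) (F : Finset (Edge 4 L)) (m : Fin Nf → ℝ)
    (κ : Fin Nf → Finset (Fin (linkUpCard L N p)) × Finset (Fin (linkUpCard L N p))) :
    Continuous (linkFeat p F m κ) := by
  unfold linkFeat
  exact continuous_finsetProd _ fun f _ => continuous_rho_comp' (continuous_linkQ_linkField p F (m f)) _ _

omit [Fact (1 < L)] in
/-- Continuous complex functions of the configuration are measurable and bounded. -/
theorem measurable_and_bounded_of_continuous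
    {Φ : GaugeConfig 4 L (Matrix.specialUnitaryGroup (Fin N) ℂ) → ℂ} (hΦ : Continuous Φ) :
    Measurable Φ ∧ ∃ K : ℝ, ∀ U, ‖Φ U‖ ≤ K := by
  haveI : SecondCountableTopology (Matrix (Fin N) (Fin N) ℂ) :=
    inferInstanceAs (SecondCountableTopology (Fin N → Fin N → ℂ))
  haveI : SecondCountableTopology (Matrix.specialUnitaryGroup (Fin N) ℂ) :=
    Topology.IsEmbedding.subtypeVal.secondCountableTopology
  refine ⟨hΦ.measurable, ?_⟩
  obtain ⟨U₀, -, hU₀⟩ := (isCompact_univ (X := GaugeConfig 4 L (Matrix.specialUnitaryGroup (Fin N) ℂ))).exists_isMaxOn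
    Set.univ_nonempty hΦ.norm.continuousOn
  exact ⟨‖Φ U₀‖, fun U => hU₀ (Set.mem_univ U)⟩

/-- Bonds between upper sites are positive-time, non-crossing links (`p + 1 ≤ L/2`). -/
theorem mem_posEdges_of_up {p : ℕ} (hp : p + 1 ≤ L / 2) (hpL : 2 * p + 2 < L) {e : Edge 4 L}
    (h1 : e.1 ∈ linkUpSites p) (h2 : e.1.shift e.2 ∈ linkUpSites p) :
    e ∈ (WilsonRP.posEdges : Finset (Edge 4 L)) ∧ e ∉ (WilsonRP.crossEdges : Finset (Edge 4 L)) := by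
  rw [mem_linkUpSites] at h1 h2
  rw [WilsonRP.mem_posEdges, WilsonRP.mem_crossEdges]
  refine ⟨⟨h1.1, by omega, h2.1, by omega⟩, ?_⟩
  rintro ⟨h0, ht⟩
  rw [val_shift_endpoint, if_pos h0] at h2
  split_ifs at h2 <;> omega

/-- **The features are admissible**: measurable, bounded, positive-time. -/
theorem linkFeat_adm {Nf : ℕ} (p : ℕ) (hp : p + 1 ≤ L / 2) (hpL : 2 * p + 2 < L) (F : Finset (Edge 4 L))
    (m : Fin Nf → ℝ) (κ : Fin Nf → Finset (Fin (linkUpCard L N p)) × Finset (Fin (linkUpCard L N p))) :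
    Measurable (linkFeat p F m κ) ∧ (∃ K : ℝ, ∀ U, ‖linkFeat p F m κ U‖ ≤ K) ∧
      DependsOn (linkFeat p F m κ) ((WilsonRP.posEdges : Finset (Edge 4 L)) : Set (Edge 4 L)) := by
  obtain ⟨hm, hb⟩ := measurable_and_bounded_of_continuous (continuous_linkFeat p F m κ)
  refine ⟨hm, hb, fun U V hUV => ?_⟩
  unfold linkFeat
  refine Finset.prod_congr rfl fun f _ => ?_
  rw [linkQ_congr_field (unitaryFundamentalRep (Fin N) ℂ) p F (W₁ := linkField U) (W₂ := linkField V)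
    (fun e h1 h2 => linkField_congr (hUV e (mem_posEdges_of_up hp hpL h1 h2).1))]

/-! ## The three gauge-fixed integrals as values of the form -/

section Integrals

variable {Nf : ℕ}

omit [Fact (1 < L)] in
/-- Scaling both arguments of the form. -/
theorem linkForm_scale (β : ℝ) (a b : ℂ) (Φ Ψ : GaugeConfig 4 L (Matrix.specialUnitaryGroup (Fin N) ℂ) → ℂ) :
    linkForm β (fun U => a * Φ U) (fun U => b * Ψ U) = b * conj a * linkForm β Φ Ψ := by
  unfold linkForm
  rw [← integral_const_mul]
  refine integral_congr_ae (ae_of_all _ fun U => ?_)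
  simp only [map_mul]
  ring

/-- **The full slab**: `Zc(F) = K₀ Σ_κ W_κ B(Φ_κ, Φ_κ)`. -/
theorem integral_full_slab (h4 : 4 ≤ L) (hL : Even L) {β : ℝ} (hβ : 0 ≤ β) (p : ℕ) (hp : 2 * p + 1 ≤ L / 2)
    (m : Fin Nf → ℝ) :
    ∫ U, (∏ f, (bondWilsonDiracAP (slabBonds (-(p : ZMod L)) (2 * p + 1))
        (LatticeRP.splice WilsonRP.crossEdges (U, 1)) (m f)).det) *
        (Real.exp (-β * wilsonAction (fundamentalRep (Fin N))
          (LatticeRP.splice WilsonRP.crossEdges (U, 1))) : ℂ)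
      ∂(Measure.pi fun _ : Edge 4 L => haarProbability (Matrix.specialUnitaryGroup (Fin N) ℂ)) =
      ((Real.exp (-β * (N * Fintype.card (Plaquette 4 L))) : ℂ) *
        ∏ f, ((m f + 4 * 1 : ℝ) : ℂ) ^
          Fintype.card {i : TorusSite 4 L × Fin N × Fin 4 //
            ¬ (i.1 ∈ linkUpSites p ∨ Site.timeReflect i.1 ∈ linkUpSites p)}) *
        ∑ κ : Fin Nf → Finset (Fin (linkUpCard L N p)) × Finset (Fin (linkUpCard L N p)),
          linkWt L N p κ * linkForm β (linkFeat p (slabBonds (-(p : ZMod L)) (2 * p + 1)) m κ)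
            (linkFeat p (slabBonds (-(p : ZMod L)) (2 * p + 1)) m κ) := by
  have hpL := two_mul_add_two_lt h4 hp
  set F := slabBonds (-(p : ZMod L)) (2 * p + 1) with hF
  set R := Fintype.card {i : TorusSite 4 L × Fin N × Fin 4 //
    ¬ (i.1 ∈ linkUpSites p ∨ Site.timeReflect i.1 ∈ linkUpSites p)} with hR
  -- pointwise Gram identity of the integrand
  have hpt : ∀ U : GaugeConfig 4 L (Matrix.specialUnitaryGroup (Fin N) ℂ),
      (∏ f, (bondWilsonDiracAP F (LatticeRP.splice WilsonRP.crossEdges (U, 1)) (m f)).det) *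
        (Real.exp (-β * wilsonAction (fundamentalRep (Fin N))
          (LatticeRP.splice WilsonRP.crossEdges (U, 1))) : ℂ) =
      ((Real.exp (-β * (N * Fintype.card (Plaquette 4 L))) : ℂ) * ∏ f, ((m f + 4 * 1 : ℝ) : ℂ) ^ R) *
        ∑ κ : Fin Nf → Finset (Fin (linkUpCard L N p)) × Finset (Fin (linkUpCard L N p)),
          linkWt L N p κ * (linkFeat p F m κ U * conj (linkFeat p F m κ (GaugeConfig.timeReflect U)) *
            linkKer β U) := by
    intro U
    have hexp := exp_neg_wilsonAction_splice hL hβ U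
    unfold linkZ at hexp
    rw [hexp]
    have hdet : ∀ f, (bondWilsonDiracAP F (LatticeRP.splice WilsonRP.crossEdges (U, 1)) (m f)).det =
        ((m f + 4 * 1 : ℝ) : ℂ) ^ R *
          ∑ x : Finset (Fin (linkUpCard L N p)) × Finset (Fin (linkUpCard L N p)),
            linkWeight L N p x.1 x.2 *
              (rho (linkQ (unitaryFundamentalRep (Fin N) ℂ) p F (linkField U) (m f)) x.1 x.2 *
                conj (rho (linkQ (unitaryFundamentalRep (Fin N) ℂ) p F
                  (linkField (GaugeConfig.timeReflect U)) (m f)) x.1 x.2)) := by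
      intro f
      rw [gram_identity_slab h4 hL p hp U (m f), Fintype.sum_prod_type]
    simp_rw [hdet]
    rw [Finset.prod_mul_distrib, Finset.prod_univ_sum]
    simp only [linkWt, linkFeat, Finset.mul_sum, Finset.sum_mul]
    refine Finset.sum_congr rfl fun κ _ => ?_
    rw [Finset.prod_mul_distrib, Finset.prod_mul_distrib, map_prod]
    ring
  simp_rw [hpt]
  rw [integral_const_mul]
  congr 1
  rw [integral_finsetSum _ fun κ _ => ?_]
  · refine Finset.sum_congr rfl fun κ _ => ?_
    rw [integral_const_mul]
    rfl
  · obtain ⟨hmeas, ⟨K, hK⟩, -⟩ := linkFeat_adm p (by omega) hpL F m κ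
    exact (integrable_linkForm_integrand hβ hmeas hmeas hK hK).const_mul (linkWt L N p κ)

/-- **The upper half**: `Zc(A) = K₀ · C · B(1, Φ_{κ₀})`, `C = ∏_f (m_f+4)^n`, `κ₀ ≡ (∅, ∅)`. -/
theorem integral_upper_slab (h4 : 4 ≤ L) (hL : Even L) {β : ℝ} (hβ : 0 ≤ β) (p : ℕ) (hp : 2 * p + 1 ≤ L / 2)
    (m : Fin Nf → ℝ) :
    ∫ U, (∏ f, (bondWilsonDiracAP (slabBonds (1 : ZMod L) p)
        (LatticeRP.splice WilsonRP.crossEdges (U, 1)) (m f)).det) *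
        (Real.exp (-β * wilsonAction (fundamentalRep (Fin N))
          (LatticeRP.splice WilsonRP.crossEdges (U, 1))) : ℂ)
      ∂(Measure.pi fun _ : Edge 4 L => haarProbability (Matrix.specialUnitaryGroup (Fin N) ℂ)) =
      ((Real.exp (-β * (N * Fintype.card (Plaquette 4 L))) : ℂ) *
        ∏ f, ((m f + 4 * 1 : ℝ) : ℂ) ^
          Fintype.card {i : TorusSite 4 L × Fin N × Fin 4 //
            ¬ (i.1 ∈ linkUpSites p ∨ Site.timeReflect i.1 ∈ linkUpSites p)}) *
        ((∏ f, ((m f + 4 * 1 : ℝ) : ℂ) ^ linkUpCard L N p) *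
          linkForm (N := N) β (fun _ => 1)
            (linkFeat (N := N) p (slabBonds (-(p : ZMod L)) (2 * p + 1)) m (fun _ => (∅, ∅)))) := by
  have hpL := two_mul_add_two_lt h4 hp
  set F := slabBonds (-(p : ZMod L)) (2 * p + 1) with hF
  set R := Fintype.card {i : TorusSite 4 L × Fin N × Fin 4 //
    ¬ (i.1 ∈ linkUpSites p ∨ Site.timeReflect i.1 ∈ linkUpSites p)} with hR
  have hQ : ∀ (W : GaugeConfig 4 L (Matrix.unitaryGroup (Fin N) ℂ)) (m' : ℝ),
      linkQ (unitaryFundamentalRep (Fin N) ℂ) p (slabBonds (1 : ZMod L) p) W m' =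
        linkQ (unitaryFundamentalRep (Fin N) ℂ) p F W m' :=
    fun W m' => linkQ_congr _ p (fun b h1 h2 => (mem_slab_iff_mem_upper_of_up hpL b h1 h2).symm) W m'
  have hpt : ∀ U : GaugeConfig 4 L (Matrix.specialUnitaryGroup (Fin N) ℂ),
      (∏ f, (bondWilsonDiracAP (slabBonds (1 : ZMod L) p) (LatticeRP.splice WilsonRP.crossEdges (U, 1)) (m f)).det) *
        (Real.exp (-β * wilsonAction (fundamentalRep (Fin N))
          (LatticeRP.splice WilsonRP.crossEdges (U, 1))) : ℂ) =
      ((Real.exp (-β * (N * Fintype.card (Plaquette 4 L))) : ℂ) * ∏ f, ((m f + 4 * 1 : ℝ) : ℂ) ^ R) *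
        ((∏ f, ((m f + 4 * 1 : ℝ) : ℂ) ^ linkUpCard L N p) *
          (linkFeat p F m (fun _ => (∅, ∅)) U * conj ((fun _ => (1 : ℂ)) (GaugeConfig.timeReflect U)) *
            linkKer β U)) := by
    intro U
    have hexp := exp_neg_wilsonAction_splice hL hβ U
    unfold linkZ at hexp
    rw [hexp]
    have hdet : ∀ f, (bondWilsonDiracAP (slabBonds (1 : ZMod L) p)
        (LatticeRP.splice WilsonRP.crossEdges (U, 1)) (m f)).det =
        ((m f + 4 * 1 : ℝ) : ℂ) ^ linkUpCard L N p *
          rho (linkQ (unitaryFundamentalRep (Fin N) ℂ) p F (linkField U) (m f)) ∅ ∅ *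
          ((m f + 4 * 1 : ℝ) : ℂ) ^ R := by
      intro f
      rw [det_bondWilsonDiracAP_splice, det_upper_slab h4 p hp, hQ, rho_empty]
    simp_rw [hdet]
    rw [Finset.prod_mul_distrib, Finset.prod_mul_distrib]
    simp only [linkFeat, map_one, mul_one]
    ring
  simp_rw [hpt]
  rw [integral_const_mul, integral_const_mul]
  rfl

/-- **The empty bond set**: `Zc(∅) = K₀ · C² · B(1, 1)`. -/
theorem integral_empty_slab (h4 : 4 ≤ L) (hL : Even L) {β : ℝ} (hβ : 0 ≤ β) (p : ℕ) (hp : 2 * p + 1 ≤ L / 2)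
    (m : Fin Nf → ℝ) :
    ∫ U, (∏ f, (bondWilsonDiracAP (∅ : Finset (Edge 4 L))
        (LatticeRP.splice WilsonRP.crossEdges (U, 1)) (m f)).det) *
        (Real.exp (-β * wilsonAction (fundamentalRep (Fin N))
          (LatticeRP.splice WilsonRP.crossEdges (U, 1))) : ℂ)
      ∂(Measure.pi fun _ : Edge 4 L => haarProbability (Matrix.specialUnitaryGroup (Fin N) ℂ)) =
      ((Real.exp (-β * (N * Fintype.card (Plaquette 4 L))) : ℂ) *
        ∏ f, ((m f + 4 * 1 : ℝ) : ℂ) ^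
          Fintype.card {i : TorusSite 4 L × Fin N × Fin 4 //
            ¬ (i.1 ∈ linkUpSites p ∨ Site.timeReflect i.1 ∈ linkUpSites p)}) *
        ((∏ f, ((m f + 4 * 1 : ℝ) : ℂ) ^ linkUpCard L N p) * (∏ f, ((m f + 4 * 1 : ℝ) : ℂ) ^ linkUpCard L N p) *
          linkForm β (fun _ : GaugeConfig 4 L (Matrix.specialUnitaryGroup (Fin N) ℂ) => (1 : ℂ)) (fun _ => 1)) := by
  set R := Fintype.card {i : TorusSite 4 L × Fin N × Fin 4 //
    ¬ (i.1 ∈ linkUpSites p ∨ Site.timeReflect i.1 ∈ linkUpSites p)} with hR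
  have hcard := card_indices_eq (N := N) h4 p hp
  have hpt : ∀ U : GaugeConfig 4 L (Matrix.specialUnitaryGroup (Fin N) ℂ),
      (∏ f, (bondWilsonDiracAP (∅ : Finset (Edge 4 L)) (LatticeRP.splice WilsonRP.crossEdges (U, 1)) (m f)).det) *
        (Real.exp (-β * wilsonAction (fundamentalRep (Fin N))
          (LatticeRP.splice WilsonRP.crossEdges (U, 1))) : ℂ) =
      ((Real.exp (-β * (N * Fintype.card (Plaquette 4 L))) : ℂ) * ∏ f, ((m f + 4 * 1 : ℝ) : ℂ) ^ R) *
        ((∏ f, ((m f + 4 * 1 : ℝ) : ℂ) ^ linkUpCard L N p) * (∏ f, ((m f + 4 * 1 : ℝ) : ℂ) ^ linkUpCard L N p) *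
          ((fun _ => (1 : ℂ)) U * conj ((fun _ => (1 : ℂ)) (GaugeConfig.timeReflect U)) * linkKer β U)) := by
    intro U
    have hexp := exp_neg_wilsonAction_splice hL hβ U
    unfold linkZ at hexp
    rw [hexp]
    have hdet : ∀ f, (bondWilsonDiracAP (∅ : Finset (Edge 4 L))
        (LatticeRP.splice WilsonRP.crossEdges (U, 1)) (m f)).det =
        ((m f + 4 * 1 : ℝ) : ℂ) ^ linkUpCard L N p * ((m f + 4 * 1 : ℝ) : ℂ) ^ linkUpCard L N p *
          ((m f + 4 * 1 : ℝ) : ℂ) ^ R := by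
      intro f
      rw [det_bondWilsonDiracAP_splice, det_empty_bonds, hcard, pow_add, pow_add]
    simp_rw [hdet]
    rw [Finset.prod_mul_distrib, Finset.prod_mul_distrib]
    simp only [map_one, mul_one, one_mul]
    ring
  simp_rw [hpt]
  rw [integral_const_mul, integral_const_mul]
  rfl

end Integrals

end Summit.QuantumFields.QCD.Theorems.UnquenchedChessboardBoundLine

end
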